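import Summits.BirchSwinnertonDyer.BirchSwinnertonDyer.Theorems.PrintCFramBottomClassIndexLawFiveLeFlipRungModularAssembly
import Summits.BirchSwinnertonDyer.BirchSwinnertonDyer.Theorems.PrintCFramBottomClassIndexLawFiveLeFlipRungOfRung
import Literature.NumberTheory.ModularForms.ModPModularFormsThetaFiltration
import HarnessLib

set_option autoImplicit false

/-!
# Crux `PrintCFram.BottomClassIndexLawFiveLe` (stmt-BirchSwinnertonDyer-20372), line `eisenstein-resource-bdp-line` (registry v27–v29):
# THE FLIPPED-CUSP RUNG FROM THE PRINTED FACTS — (Rung⁶) and (FlipRung⁶) = `stub_flipRung`'s text from NF-A ∧ NF-Q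
# (cell `bsd-print-cfram`, width seat `bsd-line-cfram-p1-w4` g19; THEOREMS ONLY, `--supports` 20372; BSD is not proved by any of this)

HONEST FRAMING. Nothing here is a statement about elliptic curves or BSD, and no summit statement is proved. This file is three one-line
compositions, recorded so that the registry's `BottomClassIndexLawFiveLe_of` can consume them BY NAME:

* `rung_six_of_facts` — (Rung⁶) (the conclusion of `FlipRung.rung_six_of_jml`, w8 g9, VERBATIM) from NF-A
  (`Cohen1975.thm31_cohenSeries_mem_halfIntModularForms`, Cohen 1975 Thm 3.1) and NF-Q (`Katz1973_qExpansionPrinciple_allCusps`, Katz 1973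
  Cor. 1.6.2): `rung_six_of_jml (jml_six_of_facts hA hKatz)` — the joint modular lemma (JML⁶) is `FlipRung.jml_six_of_facts` (this seat, file
  `…FlipRungModularAssembly`: the vehicle `g` = cut of `H_k·θ((qQ₀)²·)`, the flipped cusp `ω₀ = [a b; 4Q₀⁴ q⁴d₀]`, the slash computation T3,
  Katz at the cusp via w3 g19's `exists_twist_forall_coeff_slash_mem_nat`, the finite Fourier lemma of w6 g9).
* `flipRung_six_of_facts` — (FlipRung⁶) (the statement of registry v27's `stub_flipRung`, = the conclusion of `FlipRung.flipRung_six_of_rung`,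
  LEAD g14 p707470, VERBATIM) from NF-A and NF-Q: `flipRung_six_of_rung (rung_six_of_facts hA hKatz)`.
* `flipRung_six_of_printsCohenKatzCusps` — the same from the TEXT of registry stub `stub_printsCohenKatzCusps` (a conjunction whose components
  `.1` and `.2.2` are NF-A and NF-Q): in `BottomClassIndexLawFiveLe_of`, `stub_flipRung` may be replaced by
  `flipRung_six_of_printsCohenKatzCusps stub_printsCohenKatzCusps` (LEAD g14's announced v30 edit; this seat does not run registry verbs).

So `stub_flipRung` [PRINT-DERIVABLE, TYPING OWED] is now DERIVED in the kernel from the cite-only stub; the typing wave T1–T7 (w6 g9, w2 g14/g15,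
w4 g19, w3 g19, w8 g9, LEAD g14) is assembled. CONDITIONAL on the two named printed facts exactly as the registry intends (they are hypotheses here,
not axioms). beyond-print theorem: NO.

References: [Cohen1975] H. Cohen, Math. Ann. 217 (1975), Thm. 3.1; [Katz1973] N. Katz, p-adic properties of modular schemes and modular
forms, LNM 350, §1.6 Cor. 1.6.2; [Shimura1971] G. Shimura, Introduction to the arithmetic theory of automorphic functions, Prop. 3.64;
crux notes `Lines/eisenstein-resource-bdp-line-lead-g14.md` §2 and `…-w4g19-notes.md` Part II.
-/

-- summit-side namespace `Summit.BirchSwinnertonDyer.BirchSwinnertonDyer.…` (single-conjunct summit, D-0017 layout)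
set_option linter.dupNamespace false

noncomputable section

open scoped Classical NumberTheorySymbols
open NumberField DirichletCharacter Literature.NumberTheory.LFunctions
  Literature.NumberTheory.ModularForms Literature.NumberTheory.ModularForms.CohenEisenstein
  Literature.NumberTheory.EllipticCurves Literature.NumberTheory.EllipticCurves.KrizLi2019
  Literature.NumberTheory.QuadraticFields

namespace Summit.BirchSwinnertonDyer.BirchSwinnertonDyer.Theorems.PrintCFram.FlipRung

open Summit.BirchSwinnertonDyer.BirchSwinnertonDyer.Theorems.PrintCFram

/-- **(Rung⁶) FROM THE PRINTED FACTS.** For a class datum `(p, m, χ, k)` at the six Heegner primes, a `±1` pattern `τ` on the odd primes of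
`m` and an odd `q ∣ m` with `q·J(−1|q) ≢ 1 (mod p)`: if `‖H(k, a)‖_p ≤ p⁻¹` on the `(3,0)`-refined `τ`-cut then the same holds on the cut
flipped at `q` — from Cohen 1975 Thm 3.1 (NF-A) and Katz's q-expansion principle at all cusps (NF-Q), by `rung_six_of_jml` (w8 g9) applied to
the joint modular lemma `jml_six_of_facts`. [cite: Cohen1975, Thm. 3.1] [cite: Katz1973, §1.6 Cor. 1.6.2] [cite: Shimura1971, Prop. 3.64] -/
theorem rung_six_of_facts (hA : Cohen1975.thm31_cohenSeries_mem_halfIntModularForms)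
    (hKatz : Katz1973_qExpansionPrinciple_allCusps) :
    ∀ (p : ℕ) [Fact p.Prime] (m : ℕ) [NeZero m] (χ : DirichletCharacter ℚ_[p] m) (k : ℕ),
      (p = 7 ∨ p = 11 ∨ p = 19 ∨ p = 43 ∨ p = 67 ∨ p = 163) →
      m.Coprime p → χ.IsPrimitive → χ.IsQuadratic → (k = (p + 1) / 4 ∨ k = (3 * p - 1) / 4) →
      2 ≤ k → k ≤ p - 2 → χ (-1) * (-1) ^ k = -1 →
      ∀ (τ : ℕ → ℤ) (q : ℕ), q.Prime → q ∣ m → q ≠ 2 →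
      (∀ q' : ℕ, q'.Prime → q' ∣ m → q' ≠ 2 → (τ q' = 1 ∨ τ q' = -1)) →
      ¬ ((p : ℤ) ∣ (q : ℤ) * jacobiSym (-1) q - 1) →
      (∀ a : ℕ, m ∣ a → a / m % 4 = 3 →
        (∀ q' : ℕ, q'.Prime → q' ∣ m → q' ≠ 2 → jacobiSym (-((a / m : ℕ) : ℤ)) q' = τ q') →
        (2 ∣ m → a / m % 8 = 7) → ¬ 3 ∣ a / m → ‖((cohenH k a : ℚ) : ℚ_[p])‖ ≤ (p : ℝ)⁻¹) →
      ∀ a : ℕ, m ∣ a → a / m % 4 = 3 →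
        (∀ q' : ℕ, q'.Prime → q' ∣ m → q' ≠ 2 → jacobiSym (-((a / m : ℕ) : ℤ)) q' = (if q' = q then -τ q' else τ q')) →
        (2 ∣ m → a / m % 8 = 7) → ¬ 3 ∣ a / m → ‖((cohenH k a : ℚ) : ℚ_[p])‖ ≤ (p : ℝ)⁻¹ :=
  rung_six_of_jml (jml_six_of_facts hA hKatz)

/-- **(FlipRung⁶) = THE TEXT OF REGISTRY v27's `stub_flipRung`, FROM THE PRINTED FACTS.** For a class datum `(p, m, χ, k)` at the six
Heegner primes, a `±1` pattern `τ` and an odd `q ∣ m` with `q·J(−1|q) ≢ 1 (mod p)`: if the field factor `‖k⁻¹·B_{k,(χ↑ε₀↑)~}‖_p` is a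
non-unit at every admissible imaginary quadratic `K₀` of pattern `τ` (`d` odd, `< −4`, `3 ∤ d`, `d ≡ 1 (mod 8)` if `2 ∣ m`), then the same holds
on the pattern flipped at `q` — `flipRung_six_of_rung` (LEAD g14) after `rung_six_of_facts`. Conditional on NF-A and NF-Q (hypotheses).
[cite: Cohen1975, Thm. 3.1] [cite: Katz1973, §1.6 Cor. 1.6.2] [cite: Washington1997, Thm. 4.2] -/
theorem flipRung_six_of_facts (hA : Cohen1975.thm31_cohenSeries_mem_halfIntModularForms)
    (hKatz : Katz1973_qExpansionPrinciple_allCusps) :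
    ∀ (p : ℕ) [Fact p.Prime] (m : ℕ) [NeZero m] (χ : DirichletCharacter ℚ_[p] m) (k : ℕ),
      (p = 7 ∨ p = 11 ∨ p = 19 ∨ p = 43 ∨ p = 67 ∨ p = 163) →
      m.Coprime p → χ.IsPrimitive → χ.IsQuadratic → (k = (p + 1) / 4 ∨ k = (3 * p - 1) / 4) →
      2 ≤ k → k ≤ p - 2 → χ (-1) * (-1) ^ k = -1 →
      ∀ (τ : ℕ → ℤ) (q : ℕ), q.Prime → q ∣ m → q ≠ 2 →
      (∀ q' : ℕ, q'.Prime → q' ∣ m → q' ≠ 2 → (τ q' = 1 ∨ τ q' = -1)) →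
      ¬ ((p : ℤ) ∣ (q : ℤ) * jacobiSym (-1) q - 1) →
      (∀ (K₀ : Type) [Field K₀] [NumberField K₀] (ε₀ : DirichletCharacter ℚ_[p] (NumberField.discr K₀).natAbs),
        IsImaginaryQuadratic K₀ → Odd (NumberField.discr K₀) → NumberField.discr K₀ < -4 →
        ¬ ((3 : ℤ) ∣ NumberField.discr K₀) →
        (∀ q' : ℕ, q'.Prime → q' ∣ m → q' ≠ 2 → jacobiSym (NumberField.discr K₀) q' = τ q') →
        (2 ∣ m → NumberField.discr K₀ % 8 = 1) → IsKroneckerCharacterOf K₀ ε₀ →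
        ‖(k : ℚ_[p])⁻¹ * @generalizedBernoulli ℚ_[p] _ _
            (changeLevel (dvd_mul_right m (NumberField.discr K₀).natAbs) χ *
              changeLevel (dvd_mul_left (NumberField.discr K₀).natAbs m) ε₀).conductor ⟨conductor_ne_zero _⟩ k
            (changeLevel (dvd_mul_right m (NumberField.discr K₀).natAbs) χ *
              changeLevel (dvd_mul_left (NumberField.discr K₀).natAbs m) ε₀).primitiveCharacter‖ ≤ (p : ℝ)⁻¹) →
      ∀ (K₀ : Type) [Field K₀] [NumberField K₀] (ε₀ : DirichletCharacter ℚ_[p] (NumberField.discr K₀).natAbs),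
        IsImaginaryQuadratic K₀ → Odd (NumberField.discr K₀) → NumberField.discr K₀ < -4 →
        ¬ ((3 : ℤ) ∣ NumberField.discr K₀) →
        (∀ q' : ℕ, q'.Prime → q' ∣ m → q' ≠ 2 → jacobiSym (NumberField.discr K₀) q' = (if q' = q then -τ q' else τ q')) →
        (2 ∣ m → NumberField.discr K₀ % 8 = 1) → IsKroneckerCharacterOf K₀ ε₀ →
        ‖(k : ℚ_[p])⁻¹ * @generalizedBernoulli ℚ_[p] _ _
            (changeLevel (dvd_mul_right m (NumberField.discr K₀).natAbs) χ *
              changeLevel (dvd_mul_left (NumberField.discr K₀).natAbs m) ε₀).conductor ⟨conductor_ne_zero _⟩ k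
            (changeLevel (dvd_mul_right m (NumberField.discr K₀).natAbs) χ *
              changeLevel (dvd_mul_left (NumberField.discr K₀).natAbs m) ε₀).primitiveCharacter‖ ≤ (p : ℝ)⁻¹ :=
  flipRung_six_of_rung (rung_six_of_facts hA hKatz)

/-- **`stub_flipRung` FROM `stub_printsCohenKatzCusps` (registry v27 texts, both VERBATIM).** The hypothesis is the statement of the
cite-only stub `stub_printsCohenKatzCusps` (Cohen 1975 Thm 3.1 ∧ Katz's weight congruence and θ-filtration at every `(p, N)` ∧ Katz's
q-expansion principle at all cusps); the conclusion is the statement of `stub_flipRung`. Only the first and third conjuncts are used. In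
`BottomClassIndexLawFiveLe_of` the term `flipRung_six_of_printsCohenKatzCusps stub_printsCohenKatzCusps` has the type of `stub_flipRung`.
[cite: Cohen1975, Thm. 3.1] [cite: Katz1973, §1.6 Cor. 1.6.2] -/
theorem flipRung_six_of_printsCohenKatzCusps
    (hPCKC : Literature.NumberTheory.ModularForms.Cohen1975.thm31_cohenSeries_mem_halfIntModularForms ∧
      (∀ (p : ℕ) [Fact p.Prime] (N : ℕ),
        Literature.NumberTheory.ModularForms.ModP.WeightCongruence p N ∧
          Literature.NumberTheory.ModularForms.ModP.ThetaFiltration p N) ∧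
      Literature.NumberTheory.ModularForms.Katz1973_qExpansionPrinciple_allCusps) :
    ∀ (p : ℕ) [Fact p.Prime] (m : ℕ) [NeZero m] (χ : DirichletCharacter ℚ_[p] m) (k : ℕ),
      (p = 7 ∨ p = 11 ∨ p = 19 ∨ p = 43 ∨ p = 67 ∨ p = 163) →
      m.Coprime p → χ.IsPrimitive → χ.IsQuadratic → (k = (p + 1) / 4 ∨ k = (3 * p - 1) / 4) →
      2 ≤ k → k ≤ p - 2 → χ (-1) * (-1) ^ k = -1 →
      ∀ (τ : ℕ → ℤ) (q : ℕ), q.Prime → q ∣ m → q ≠ 2 →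
      (∀ q' : ℕ, q'.Prime → q' ∣ m → q' ≠ 2 → (τ q' = 1 ∨ τ q' = -1)) →
      ¬ ((p : ℤ) ∣ (q : ℤ) * jacobiSym (-1) q - 1) →
      (∀ (K₀ : Type) [Field K₀] [NumberField K₀] (ε₀ : DirichletCharacter ℚ_[p] (NumberField.discr K₀).natAbs),
        IsImaginaryQuadratic K₀ → Odd (NumberField.discr K₀) → NumberField.discr K₀ < -4 →
        ¬ ((3 : ℤ) ∣ NumberField.discr K₀) →
        (∀ q' : ℕ, q'.Prime → q' ∣ m → q' ≠ 2 → jacobiSym (NumberField.discr K₀) q' = τ q') →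
        (2 ∣ m → NumberField.discr K₀ % 8 = 1) → IsKroneckerCharacterOf K₀ ε₀ →
        ‖(k : ℚ_[p])⁻¹ * @generalizedBernoulli ℚ_[p] _ _
            (changeLevel (dvd_mul_right m (NumberField.discr K₀).natAbs) χ *
              changeLevel (dvd_mul_left (NumberField.discr K₀).natAbs m) ε₀).conductor ⟨conductor_ne_zero _⟩ k
            (changeLevel (dvd_mul_right m (NumberField.discr K₀).natAbs) χ *
              changeLevel (dvd_mul_left (NumberField.discr K₀).natAbs m) ε₀).primitiveCharacter‖ ≤ (p : ℝ)⁻¹) →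
      ∀ (K₀ : Type) [Field K₀] [NumberField K₀] (ε₀ : DirichletCharacter ℚ_[p] (NumberField.discr K₀).natAbs),
        IsImaginaryQuadratic K₀ → Odd (NumberField.discr K₀) → NumberField.discr K₀ < -4 →
        ¬ ((3 : ℤ) ∣ NumberField.discr K₀) →
        (∀ q' : ℕ, q'.Prime → q' ∣ m → q' ≠ 2 → jacobiSym (NumberField.discr K₀) q' = (if q' = q then -τ q' else τ q')) →
        (2 ∣ m → NumberField.discr K₀ % 8 = 1) → IsKroneckerCharacterOf K₀ ε₀ →
        ‖(k : ℚ_[p])⁻¹ * @generalizedBernoulli ℚ_[p] _ _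
            (changeLevel (dvd_mul_right m (NumberField.discr K₀).natAbs) χ *
              changeLevel (dvd_mul_left (NumberField.discr K₀).natAbs m) ε₀).conductor ⟨conductor_ne_zero _⟩ k
            (changeLevel (dvd_mul_right m (NumberField.discr K₀).natAbs) χ *
              changeLevel (dvd_mul_left (NumberField.discr K₀).natAbs m) ε₀).primitiveCharacter‖ ≤ (p : ℝ)⁻¹ :=
  flipRung_six_of_facts hPCKC.1 hPCKC.2.2

end Summit.BirchSwinnertonDyer.BirchSwinnertonDyer.Theorems.PrintCFram.FlipRung

end
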